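import Literature.NumberTheory.EllipticCurves.KuriharaNumberInvariants
import Literature.NumberTheory.EllipticCurves.KuriharaNumberKimShaLength
import Literature.NumberTheory.EllipticCurves.Rank1Residual.Predicates
import Literature.NumberTheory.EllipticCurves.BSDRootNumberSmallConductorProofs
import HarnessLib

/-!
# Census relation X11b-2 (Kurihara numbers at a multiplicative prime `p ‖ N`, analytic rank one),
# TYPED (census cell `bsd-formula-census` worker W3, seat conjecture-typer 2, CELL-PLAN §3 H-3;
# shape registered in `HOME/b2b-bsdres-census-ctyper2/H3-TYPING-PREP.md` BEFORE the P3 shards were read)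

HONEST FRAMING (run/shared/lean/b2b/bsd-rank1-residual/, verbatim in every file): the goal of the
cell is to DELETE the COMBINATION-SHAPED residual classes of the Birch–Swinnerton-Dyer formula for
ALL analytic-rank `≤ 1` elliptic curves over `ℚ` — "full BSD formula for every rank `≤ 1` curve in
class `C`" assembled STRICTLY from published theorems — so that the rank-`≤ 1` remainder becomes
exactly the CONSTRUCTION-SHAPED classes, which are TYPED (missing-input `Prop`s), NOT attempted.
This is not "finishing BSD". Research route; no claim beyond the stated classes; census output =
EVIDENCE / conjecture items, never a Literature fact; `r = 0` cells CALIBRATION, `r = 1` cells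
CANDIDATE / EVIDENCE; pre-registered criteria before any table is read. Nothing below is booked; no
label or RESIDUAL-MAP mark is touched; X11b (N8/O2) stays CONSTRUCTION-SHAPED.

## The relation (pre-registered: `run/shared/lean/ttrl/bsd-formula-census/PLAN.md` §5 DRAFT 21 P3 +
## amendment P3b DRAFT 24, both written before any P3 shard was read; engine `bsdc_x11b2_job.py`
## f2cae647, folds `bsdc_x11b2_fold.py` / `bsdc_x11b2_kurfold.py` 63a61c8c, engine 2 = the Kurihara
## lane's `kurlib2.py` sha256 f638f8df… vendored read-only; STEP-0 `X11B2-KUR-STEP0.md` 5a40a3df… PASS)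

(P) primary, per `p`: "`δ̃_ℓ ≢ 0 (mod p)` for SOME tested Kolyvagin prime `ℓ` ⟺ `p ∤ #Ш_an · ∏_ℓ c_ℓ`
(`c_p` INCLUDED)". (R) refinement at `p ∈ {3, 5}`: "min over tested `ℓ ∈ 𝒫₂` of `v_p(δ̃_ℓ mod p²)`
vs `ord_p(#Ш_an · ∏ c_ℓ) ∈ {0, 1, ≥ 2}`", the `v < ord` cells being the discovery reading (EMPTY under
the Kim shape). STATEMENT-DISCOVERY ITEM **(D2)** (`LEADERBOARD.jsonl` row `46f76e37330e902f`, field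
`statement_D2`, verbatim): *"for every Kolyvagin prime l in P_k: v_p(delta_l mod p^k) >= min(k,
ord_p(#Sha * prod_{all l'} c_l')) with c_p INCLUDED"* (X11B2-REPORT v0 §D (D2)).

## VERDICT OF RECORD (W3, `run/shared/lean/ttrl/bsd-formula-census/X11B2-REPORT.md` **v0 — INTERIM**,
## 2026-08-21T19:30Z, sha256 2b93671fec3b976cff06daf95b1d8af11307766ec900f61685539a4d7673fd34; Engine-C
## lead review **ACCEPT (v0 INTERIM, N ≤ 3 000 universe; window wave pending → v1)** by cp-bsdcensus2,
## recomputed from the tables; relayed HOME INBOX l.6794 / `run/shared/lean/prim/CENSUS-RELAYS-X11B2.md`)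

EVIDENCE (label EVIDENCE — a per-pair table, "no fit"; NOT a theorem; never a Literature fact).
Universe: ALL 4 471 (Cremona curve #1, `p`) pairs with `p ‖ N`, analytic rank `1`, `E[p]` IRREDUCIBLE
(no galrep code B/Cs at `p`; cross-checked against multr1-p2 census3 at `p = 3`: 1 449/1 449 in,
0/116 reducible in), `N ≤ 3 000`, `p ∈ {3, 5, 7, 11, 13}` (`p = 3`: 1 449 · `5`: 1 136 · `7`: 863 ·
`11`: 548 · `13`: 475); Kolyvagin primes `ℓ ≤ 3 000`, level `k = 1` at every `p` and `k = 2` at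
`p ∈ {3, 5}`; 28 rows (@11/@13) have no Kolyvagin prime `ℓ ≤ 3 000` (listed, never read as evidence).
Table `x11b2/X11B2-P3-N3000.tsv` sha256 e5457b0754b77dbc27e239e0067e6759fbdb09386e4d6c8fc8643d3cd02686b3
(4 471 rows; per pair: levels `ℓ:δ mod p` / `mod p²`, cp, tam, tam_away, sha_an, ord, ram, ptors,
img, cp_only, cyc_fail, engines), fold `x11b2/X11B2-P3-N3000-fold.md` sha256 771a82f6790397da…,
`x11b2/SHA256SUMS` e3584c40… (90 files; `sha256sum -c` 0 failures by the lead and by this seat,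
2026-08-21T19:48Z); kit jobs P3 `j119322` / `j119516` / `j119691` / `j119692` (≈ 11.9 core-h, tag
`bsdcensus`), canary `j119086`, STEP-0b `j118871`; `LEADERBOARD.jsonl` sha256 7506466ce1f72890…, row
`46f76e37330e902f` "X11b-2/P3-N3000", kind "EVIDENCE TABLE (no fit)", status "claimed — EVIDENCE TABLE
for statement-discovery item D2", review cp-bsdcensus2 ACCEPT (v0 INTERIM). TWO `δ` ENGINES (W3
`msfromell` full-sum; the Kurihara lane's impl-2 `kurlib2.py`, `msinit` Hecke-kernel eigensymbol +
analytic Birch anchors) agree on **17 342/17 342** Kurihara numbers (engine 2 on 4 443/4 471 rows), 0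
mismatches. READINGS, level 1 (2×2 per `p`, recomputed by the reviewer from `levels_k1`): (`p ∤ #Ш_an∏c`,
some `δ ≢ 0`) **3 709** · (`p ∣ #Ш_an∏c`, some `δ ≢ 0`) **0 = the "should be empty" cell, EMPTY at every
`p`** · (`p ∤`, all `≡ 0`) 43 · (`p ∣`, all `≡ 0`) **691** (by `p`: 463 / 156 / 57 / 10 / 5) — so on the
691 rows with `p ∣ #Ш_an·∏c_ℓ` EVERY tested `δ̃_ℓ ≡ 0 (mod p)`, in particular on the 218 "c_p-only"
rows (`p ∣ c_p`, `p ∤ #Ш_an·∏_{ℓ≠p} c_ℓ`; 138 @3, 68 @5, 12 @7; all split) every `δ̃_ℓ ≡ 0`: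
**218/218**; restricted to cyclic levels the 2×2 is 3 709 · 0 · 42 · 690 (Kim's cyclicity flag fails
at ≥ 1 tested level on 1 046 rows, carried per level in its own column). Level 2 (P3b, `p ∈ {3, 5}`,
`ℓ ≡ 1 mod p²`): min over tested `ℓ ∈ 𝒫₂` of `v_p(δ̃_ℓ mod p²)` is NEVER below `min(2, ord_p(#Ш_an∏c))`
— **0 violations on 2 405 rows** with a level-2 prime (equality on 338/408 @3 and 102/122 @5 of the
`ord = 1` rows, the rest "≥ 2" = accidental extra vanishing, listed). The converse reading ("some tested
`δ̃_ℓ` is a unit when `p ∤ #Ш_an∏c`") holds on 3 709/3 752 tested rows, the 43 exceptions (15 @3, 5 @5,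
2 @7 with 3 levels; 9 @11, 12 @13 with 1–2 levels) being all-levels-accidental candidates to re-test at
more levels — "listed, never read as evidence" (W3). **CAVEAT stated by W3 and kept here: `#Ш_an = 1` on
ALL 4 471 rows**, so the `#Ш_an` factor of (D2) is NOT exercised by this table (its place in the shape
comes from Kim's clause (6)); what the table exercises is `min(k, ord_p ∏_ℓ c_ℓ)` with `c_p` included.
v1 = the O2/N8 window wave (771 rows `N < 2·10⁴`) is RUNNING and folds into X11B2-REPORT v1; this
docstring is amended DOC-ONLY when v1 is of record (declarations unchanged), as for X11b-1 (p253226).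

## What is typed

**(D2) = `CensusX11b2.KolyvaginDivisibilityAt W p` (`@[conjecture]`)**: for every Kolyvagin prime
`ℓ ∈ 𝒫_1(E, p)` the Kurihara number `δ̃_ℓ` is divisible by `p^m`, `m := ord_p(#Ш_an · ∏_ℓ c_ℓ) ∈ ℕ`,
in the tree's sense `KuriharaDivisibleAt W p f ℓ m` (`KuriharaNumberInvariants.lean`): for every
`k ≤ m` with `ℓ ∈ 𝒫_k` and every surjective discrete logarithm, `δ̃_ℓ^{(k)} = 0` in `ℤ/p^k` — which is
exactly "`v_p(δ̃_ℓ mod p^k) ≥ min(k, m)` for `ℓ ∈ 𝒫_k`" (for `k ≤ m`: `δ̃_ℓ^{(k)} = 0`; for `k > m`: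
`δ̃_ℓ^{(m)} = δ̃_ℓ^{(k)} mod p^m = 0`). NO cyclicity restriction on `ℓ` (W3 tested all Kolyvagin primes;
the inequality held at the non-cyclic levels too); over the CYCLIC levels it gives `m ≤ ∂^{(1)}(δ̃)`
(`le_kuriharaPartial_one_of_kolyvaginDivisibilityAt`, PROVED). **The equality shape =
`CensusX11b2.PartialOneAt W p` (`@[conjecture]`)**: Kim's clause (6) in analytic rank one,
`length Ш(E/ℚ)[p^∞] = ∂^{(1)}(δ̃) − ∂^{(∞)}(δ̃)` (Amer. J. Math. 148 (2026) Thm. 1.8 = arXiv Thm. 1.9),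
COMBINED with Kim's Conjecture 1.10 `∂^{(∞)}(δ̃) = ∑_{ℓ ∣ N} ord_p c_ℓ` and `#Ш ↦ #Ш_an`:
`∂^{(1)}(δ̃) = ord_p(#Ш_an · ∏ c_ℓ)` over the cyclic Kolyvagin primes (`kuriharaPartial W p f 1`); it
implies (D2) at the cyclic primes (`kuriharaDivisibleAt_of_partialOneAt`, PROVED) and adds the WITNESS
half (some cyclic `ℓ` has index exactly `m`), for which the census has only the finite-level reading
3 709/3 752 at `m = 0`. (P) is the reading "`= 0` on both sides" (PROVED corollaries
`partialOne_eq_zero_iff_of_partialOneAt`, `padicValRat_eq_zero_of_ne_zero_of_kolyvaginDivisibilityAt`).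
The census instantiates, per pair, finitely many tested `ℓ`; the typed predicates quantify over ALL
Kolyvagin primes / cyclic levels (units of `ℤ/p^k` — period transfer `hu`, `c_E ∈ {1,2}` — are invisible).

DICTIONARY (census engine ↔ tree; W3 `bsdc_x11b2_job.py` f2cae647 per `X11B2-KUR-STEP0.md`, engine 2 =
Kurihara lane `kurlib2.py` f638f8df): engine symbol `[a/n] := mseval(msfromell(E) x⁺, {∞→a/n})/c_E`,
PARI's `x⁺` normalised by `E.omega[1] = Ω_E/c_E` (`c_E = c_∞ ∈ {1,2}`), i.e. Kim's `[a/n]⁺`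
(Ω_E-normalised; `[−a/n] = [a/n]` and full sum = half sum checked 200/200 at STEP-0b `j118871`); the
tree's `ratPlusSymbol f (a/n) = [a/n]⁺_f` is `Ω⁺_f`-normalised, so under `Ω(W) = u·Ω⁺_f` (hypothesis
`hu`, `|u|_p = 1`) `δ̃_n^{(k)}(engine) = ū⁻¹ · kuriharaNumber f (p^k) n ψ` in `ℤ/p^k` — a UNIT factor,
invisible below; `ψ_ℓ` = discrete logarithm for the SMALLEST primitive root mod `ℓ` (one surjective
choice; the tree quantifies over all surjective `ψ`, `kuriharaNumber_eq_zero_iff_of_surjective`);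
Kolyvagin primes `ℓ ∤ Np`, `ℓ ≡ 1`, `a_ℓ ≡ ℓ + 1 (mod p^k)` = `Kato.IsKolyvaginPrime W p k ℓ`; cyclicity
flag `#Ẽ(𝔽_ℓ)[p] ≤ p` = the second conjunct of `IsCyclicKolyvaginLevel`; `#Ш_an` = Cremona's `allbsd`
value = `shaAn W`; `∏ c_ℓ` over ALL bad primes, `c_p` included = `W.tamagawaProduct`; "`v_p(δ_ℓ mod p^k)
≥ j`" (`j ≤ k`) = `kuriharaNumber f (p^j) ℓ ψ = 0` = the `k = j` instance inside `KuriharaDivisibleAt`.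

KNOWN IN PRINT (companion record; all in the tree, no new Literature fact): at `p ≥ 5`, `ρ̄` onto,
`p ‖ N`, `r_an = 1`, a UNIT `δ̃_ℓ` at a cyclic prime level ⟹ `Ш(E/ℚ)[p^∞] = 0` — Kim 2026 Thm. 1.8
(1),(6) + Cor. 1.6, tree fact `Kim2022_rankOne_card_sha_eq_one_of_kuriharaNumber_ne_zero` ("good or
multiplicative"): so the "unit ⟹ `p ∤ #Ш`" half of (P) on that sub-locus is CALIBRATION-IN-PRINT (with
`#Ш`, not `#Ш_an`; bridge `card_sha_primary_eq_one_of_divIndex_eq_zero` below); the Tamagawa half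
"unit ⟹ `p ∤ ∏c`" is Kim's Conjecture 1.10 direction (OPEN); the (D2) direction "`p^m ∣ δ̃_ℓ` for
`m = ord_p(#Ш·∏c)`" is clause (6) "`∂^{(1)} ≥ length Ш[p^∞] + ∂^{(∞)}`" PLUS the Conjecture-1.10 half
"`∂^{(∞)} ≥ ∑ ord_p c_ℓ`" PLUS `#Ш[p^∞] = |#Ш_an|_p⁻¹` — NOT in print as a whole at `p ‖ N`; the converse
"`p ∤ #Ш_an∏c` ⟹ a unit `δ̃_ℓ` exists" is NOT in print at `p ‖ N` beyond Kim's Thm. 1.9 (1) "IF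
`ord(δ̃) < ∞`"; at `p = 3` nothing is in print (Kim arXiv:2505.09121 Thm. 1.1, large image, is
ANNOUNCED — `Kim2025/LargeImageStructureOPEN.lean`, label 'not in print').
[cite: Kim2022StructureSelmer, Thm. 1.9 (1),(6), Conj. 1.10, §1.5.1] [cite: Kurihara2014, §3.1]
NOT touched: STEP L (`IndexLowerBoundAt`), the split-3 node `CensusLeadingTermSplit` (X11b-1), any
RESIDUAL-MAP mark; X11b-2 is its own node (Kato–Kurihara side); common consumer only `BSD(E, p)`.
-/

noncomputable section

open scoped Classical MatrixGroups ModularForm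

open CongruenceSubgroup WeierstrassCurve Literature.NumberTheory.EllipticCurves
  Literature.NumberTheory.EllipticCurves.ModularForms
  Literature.NumberTheory.EllipticCurves.Rank1Residual

namespace Summit.BirchSwinnertonDyer.Rank1Residual.X11b

/-! ### §1 The typed relations -/

/-- **Census item (D2) = relation X11b-2, typed: Kim-shape divisibility of the Kurihara numbers at a
multiplicative prime, `c_p` INCLUDED.** For `W/ℚ` globally minimal elliptic, `p` odd, `p ‖ N`
(multiplicative), `E[p]` irreducible, `ord_{s=1} L(E,s) = 1`, `f` the newform of `W` with the period
transfer `Ω(W) = u·Ω⁺_f`, `|u|_p = 1`: for the rational number `s = #Ш(E/ℚ)_an`, the integer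
`m := ord_p(s · ∏_ℓ c_ℓ)` (ALL bad primes, `c_p` included) is a natural number and EVERY Kolyvagin prime
`ℓ ∈ 𝒫_1(E,p)` has `δ̃_ℓ ∈ p^m ℤ_p/I_ℓ` (`KuriharaDivisibleAt W p f ℓ m`: for all `k ≤ m` with `ℓ ∈ 𝒫_k`,
`δ̃_ℓ^{(k)} = 0` — i.e. "`v_p(δ̃_ℓ mod p^k) ≥ min(k, m)` for `ℓ ∈ 𝒫_k`", W3's wording verbatim).
EVIDENCE (census stage P3, X11B2-REPORT v0 INTERIM sha256 2b93671f…, table e5457b07…, LEADERBOARD row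
46f76e37330e902f, review ACCEPT by a second seat; two `δ` engines 17 342/17 342): level 1 — on the 691
rows with `p ∣ #Ш_an·∏c` every tested `δ̃_ℓ ≡ 0 (mod p)` (691/691; c_p-only sub-cell 218/218; the
"should be empty" cell `(p ∣ #Ш_an∏c, some δ̃_ℓ ≢ 0)` has 0 rows at every `p`); level 2 (`p ∈ {3,5}`) —
0 violations of `min v_p(δ̃_ℓ mod p²) ≥ min(2, m)` on 2 405 rows; `#Ш_an = 1` on all 4 471 rows (the
`#Ш_an` factor is NOT exercised; shape from Kim's clause (6)). EVIDENCE; NOT a theorem. Printed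
antecedents: Kim 2026 Thm. 1.8 (6), Kim Conj. 1.10, BSD (`#Ш = #Ш_an`). Nothing asserted.
[cite: Kim2022StructureSelmer, Thm. 1.9 (6) (PDF pp. 7–8), Conj. 1.10 (PDF p. 8), §1.5.1 (PDF p. 7)] -/
@[conjecture] def CensusX11b2.KolyvaginDivisibilityAt (W : WeierstrassCurve ℚ) (p : ℕ) [Fact p.Prime] :
    Prop :=
  ∀ [W.IsElliptic] [W.IsGloballyMinimal], p ≠ 2 → W.HasMultiplicativeReductionAtPrime p →
    W.HasIrreducibleModPGaloisRep p → W.analyticRank = 1 →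
    ∀ ⦃N : ℕ⦄ [NeZero N] (f : CuspForm (Gamma0 N) 2), IsNewformOf W f →
    (∃ u : ℚ, ‖(u : ℚ_[p])‖ = 1 ∧ W.realPeriodRat = u * plusPeriod f) →
    ∀ (s : ℚ), shaAn W = (s : ℂ) →
      ∃ m : ℕ, padicValRat p (s * W.tamagawaProduct) = m ∧
        ∀ ℓ : ℕ, Kato.IsKolyvaginPrime W p 1 ℓ → KuriharaDivisibleAt W p f ℓ m

/-- **Census relation X11b-2, equality shape: `∂^{(1)}(δ̃) = ord_p(#Ш_an · ∏_{ℓ∣N} c_ℓ)`.** Same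
hypotheses as `CensusX11b2.KolyvaginDivisibilityAt`; conclusion: the integer `ord_p(s · ∏_ℓ c_ℓ)` (ALL
bad primes, `c_p` included) is a natural number `k` and equals Kim's `∂^{(1)}(δ̃)` over the cyclic
Kolyvagin primes (`kuriharaPartial W p f 1`) — Kim's clause (6) in rank one COMBINED with Conjecture
1.10 and `#Ш ↦ #Ш_an`. It implies (D2) at the cyclic Kolyvagin primes
(`kuriharaDivisibleAt_of_partialOneAt`) and adds the WITNESS half "some cyclic `ℓ` has index exactly
`k`", for which the census reading is finite-level only: at `k = 0`, a unit `δ̃_ℓ` was found on 3 709 of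
the 3 752 tested rows with `p ∤ #Ш_an∏c`, the 43 others (15 @3, 5 @5, 2 @7 with 3 levels; 9 @11, 12
@13 with 1–2 levels) being "all-levels-accidental candidates to re-test at more levels — listed, never
read as evidence" (X11B2-REPORT v0). EVIDENCE (same record as (D2)); CANDIDATE; NOT a theorem. Printed
antecedents: Kim 2026 Thm. 1.8 (6) (rank one: `length Ш[p^∞] = ∂^{(1)} − ∂^{(∞)}`, `p ≥ 5`, `ρ̄` onto),
Kim Conj. 1.10 (`∂^{(∞)} = ∑ ord_p c_ℓ`, OPEN), BSD (`#Ш = #Ш_an`). Nothing asserted.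
[cite: Kim2022StructureSelmer, Thm. 1.9 (6) (PDF pp. 7–8), Conj. 1.10 (PDF p. 8), §1.5.1 (PDF p. 7)] -/
@[conjecture] def CensusX11b2.PartialOneAt (W : WeierstrassCurve ℚ) (p : ℕ) [Fact p.Prime] : Prop :=
  ∀ [W.IsElliptic] [W.IsGloballyMinimal], p ≠ 2 → W.HasMultiplicativeReductionAtPrime p →
    W.HasIrreducibleModPGaloisRep p → W.analyticRank = 1 →
    ∀ ⦃N : ℕ⦄ [NeZero N] (f : CuspForm (Gamma0 N) 2), IsNewformOf W f →
    (∃ u : ℚ, ‖(u : ℚ_[p])‖ = 1 ∧ W.realPeriodRat = u * plusPeriod f) →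
    ∀ (s : ℚ), shaAn W = (s : ℂ) →
      ∃ k : ℕ, padicValRat p (s * W.tamagawaProduct) = k ∧ kuriharaPartial W p f 1 = k

/-! ### §2 The divisibility index: attained bounds; `∂^{(1)} = 0` iff SOME cyclic Kolyvagin prime carries a unit -/

section LevelOne

variable {W : WeierstrassCurve ℚ} [W.IsGloballyMinimal] {p : ℕ} {N : ℕ} {f : CuspForm (Gamma0 N) 2}

/-- `kuriharaDivIndex n = 0` iff `δ̃_n` is NOT divisible by `p` in `ℤ_p/I_n` (`¬ KuriharaDivisibleAt n 1`):
the index is the supremum of the `j` with `δ̃_n ∈ p^j(ℤ_p/I_n)`, a down-closed set containing `0`.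
[cite: Kim2022StructureSelmer, §2.5.1 (PDF p. 13), Def. 2.13 (PDF p. 14)] -/
theorem kuriharaDivIndex_eq_zero_iff (n : ℕ) :
    kuriharaDivIndex W p f n = 0 ↔ ¬ KuriharaDivisibleAt W p f n 1 := by
  constructor
  · intro h h1
    have := le_kuriharaDivIndex_of_divisibleAt W p f h1
    rw [h] at this
    exact absurd this (by norm_num)
  · intro h1
    rw [kuriharaDivIndex]
    refine le_antisymm ?_ bot_le
    refine iSup₂_le fun j hj => ?_
    rcases Nat.eq_zero_or_pos j with rfl | hjpos
    · simp
    · exact absurd (hj.anti hjpos) h1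

/-- **A natural-number lower bound on the divisibility index is attained**: `j ≤ kuriharaDivIndex n`
gives `KuriharaDivisibleAt n j` (the set of such `j` is down-closed, `KuriharaDivisibleAt.anti`, and
contains `0`). [cite: Kim2022StructureSelmer, §2.5.1 (PDF p. 13), Def. 2.13 (PDF p. 14)] -/
theorem kuriharaDivisibleAt_of_le_kuriharaDivIndex {n j : ℕ}
    (h : (j : ℕ∞) ≤ kuriharaDivIndex W p f n) : KuriharaDivisibleAt W p f n j := by
  by_contra hnot
  rcases Nat.eq_zero_or_pos j with rfl | hj
  · exact hnot (kuriharaDivisibleAt_zero W p f n)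
  · -- every `j'` with `δ̃_n ∈ p^{j'}` has `j' < j`, so the index is `≤ j - 1 < j`
    have hlt : ∀ j', KuriharaDivisibleAt W p f n j' → j' ≤ j - 1 := fun j' hj' =>
      Nat.le_sub_one_of_lt (lt_of_not_ge fun hle => hnot (hj'.anti hle))
    have hle : kuriharaDivIndex W p f n ≤ ((j - 1 : ℕ) : ℕ∞) := by
      rw [kuriharaDivIndex_def]
      exact iSup₂_le fun j' hj' => by exact_mod_cast hlt j' hj'
    have : (j : ℕ∞) ≤ ((j - 1 : ℕ) : ℕ∞) := h.trans hle
    have : j ≤ j - 1 := by exact_mod_cast this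
    omega

/-- **`∂^{(1)}(δ̃) = 0` iff some cyclic Kolyvagin PRIME `ℓ` has `kuriharaDivIndex ℓ = 0`** (an infimum in
`ℕ∞` vanishes iff some member does; the levels with one prime factor are the primes).
[cite: Kim2022StructureSelmer, §1.5.1 (PDF p. 7)] -/
theorem kuriharaPartial_one_eq_zero_iff :
    kuriharaPartial W p f 1 = 0 ↔
      ∃ ℓ : ℕ, ℓ.Prime ∧ IsCyclicKolyvaginLevel W p ℓ ∧ kuriharaDivIndex W p f ℓ = 0 := by
  rw [kuriharaPartial]
  constructor
  · intro h
    by_contra hne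
    have hne' : ∀ ℓ : ℕ, ℓ.Prime → IsCyclicKolyvaginLevel W p ℓ → kuriharaDivIndex W p f ℓ ≠ 0 :=
      fun ℓ h1 h2 h3 => hne ⟨ℓ, h1, h2, h3⟩
    have hpos : ∀ n, IsCyclicKolyvaginLevel W p n → n.primeFactors.card = 1 →
        1 ≤ kuriharaDivIndex W p f n := by
      intro n hn hcard
      obtain ⟨ℓ, hℓ⟩ := Finset.card_eq_one.mp hcard
      have hℓp : ℓ ∈ n.primeFactors := by rw [hℓ]; exact Finset.mem_singleton_self ℓ
      have hprime : ℓ.Prime := Nat.prime_of_mem_primeFactors hℓp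
      -- `n` square-free with a single prime factor: `n = ℓ`
      have hn' : n = ℓ := by
        have hsq : Squarefree n := hn.1.1
        have := Nat.prod_primeFactors_of_squarefree hsq
        rw [hℓ, Finset.prod_singleton] at this
        exact this.symm
      subst hn'
      have h0 : kuriharaDivIndex W p f n ≠ 0 := hne' n hprime hn
      exact Order.one_le_iff_ne_zero.mpr h0
    have : (1 : ℕ∞) ≤ ⨅ (n : ℕ) (_ : IsCyclicKolyvaginLevel W p n) (_ : n.primeFactors.card = 1),
        kuriharaDivIndex W p f n :=
      le_iInf fun n => le_iInf fun hn => le_iInf fun hc => hpos n hn hc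
    rw [h] at this
    exact absurd this (by norm_num)
  · rintro ⟨ℓ, hprime, hcyc, h0⟩
    refine le_antisymm ?_ bot_le
    have hcard : ℓ.primeFactors.card = 1 := by
      rw [hprime.primeFactors, Finset.card_singleton]
    calc ⨅ (n : ℕ) (_ : IsCyclicKolyvaginLevel W p n) (_ : n.primeFactors.card = 1),
          kuriharaDivIndex W p f n
        ≤ kuriharaDivIndex W p f ℓ := iInf_le_of_le ℓ (iInf_le_of_le hcyc (iInf_le_of_le hcard le_rfl))
      _ = 0 := h0

/-- A cyclic Kolyvagin level with exactly one prime factor IS a Kolyvagin prime of level 1. [cite: Kim2022StructureSelmer, §1.2.2] -/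
theorem isKolyvaginPrime_of_isCyclicKolyvaginLevel_of_card_eq_one {n : ℕ}
    (hn : IsCyclicKolyvaginLevel W p n) (hcard : n.primeFactors.card = 1) :
    n.Prime ∧ Kato.IsKolyvaginPrime W p 1 n := by
  obtain ⟨ℓ, hℓ⟩ := Finset.card_eq_one.mp hcard
  have hℓp : ℓ ∈ n.primeFactors := by rw [hℓ]; exact Finset.mem_singleton_self ℓ
  have hprime : ℓ.Prime := Nat.prime_of_mem_primeFactors hℓp
  have hn' : n = ℓ := by
    have := Nat.prod_primeFactors_of_squarefree hn.1.1
    rw [hℓ, Finset.prod_singleton] at this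
    exact this.symm
  subst hn'
  exact ⟨hprime, hn.1.isKolyvaginPrime hprime (dvd_refl n)⟩

end LevelOne

/-! ### §3 (D2) versus the equality shape, the readings (P), and the in-print half -/

section Readings

variable {W : WeierstrassCurve ℚ} [W.IsElliptic] [W.IsGloballyMinimal] {p : ℕ} [Fact p.Prime]
  {N : ℕ} [NeZero N] {f : CuspForm (Gamma0 N) 2}

/-- **(D2) bounds `∂^{(1)}(δ̃)` from below**: under `CensusX11b2.KolyvaginDivisibilityAt W p` and its
hypotheses, `m = ord_p(#Ш_an·∏c) ≤ ∂^{(1)}(δ̃)` (every cyclic Kolyvagin prime is a Kolyvagin prime; each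
has index `≥ m`; `∂^{(1)}` is their infimum). CONDITIONAL on an EVIDENCE-labelled conjecture; nothing
asserted. [cite: Kim2022StructureSelmer, Thm. 1.9 (6), Conj. 1.10, Def. 2.13] -/
theorem CensusX11b2.le_kuriharaPartial_one_of_kolyvaginDivisibilityAt
    (h : CensusX11b2.KolyvaginDivisibilityAt W p)
    (hp : p ≠ 2) (hmult : W.HasMultiplicativeReductionAtPrime p) (hirr : W.HasIrreducibleModPGaloisRep p)
    (hr : W.analyticRank = 1) (hf : IsNewformOf W f)
    (hu : ∃ u : ℚ, ‖(u : ℚ_[p])‖ = 1 ∧ W.realPeriodRat = u * plusPeriod f)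
    {s : ℚ} (hs : shaAn W = (s : ℂ)) :
    ∃ m : ℕ, padicValRat p (s * W.tamagawaProduct) = m ∧ (m : ℕ∞) ≤ kuriharaPartial W p f 1 := by
  obtain ⟨m, hm, hdiv⟩ := h hp hmult hirr hr f hf hu s hs
  refine ⟨m, hm, ?_⟩
  rw [kuriharaPartial_def]
  refine le_iInf fun n => le_iInf fun hn => le_iInf fun hc => ?_
  obtain ⟨_, hKP⟩ := isKolyvaginPrime_of_isCyclicKolyvaginLevel_of_card_eq_one hn hc
  exact le_kuriharaDivIndex_of_divisibleAt W p f (hdiv n hKP)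

/-- **The equality shape implies (D2) at the cyclic Kolyvagin primes**: under
`CensusX11b2.PartialOneAt W p` and its hypotheses, every cyclic Kolyvagin prime `ℓ` has
`δ̃_ℓ ∈ p^k ℤ_p/I_ℓ` for `k = ord_p(#Ш_an·∏c)` (`∂^{(1)} = k ≤ index(ℓ)`, and an attained bound,
`kuriharaDivisibleAt_of_le_kuriharaDivIndex`). CONDITIONAL; nothing asserted.
[cite: Kim2022StructureSelmer, Thm. 1.9 (6), Conj. 1.10, Def. 2.13] -/
theorem CensusX11b2.kuriharaDivisibleAt_of_partialOneAt (h : CensusX11b2.PartialOneAt W p)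
    (hp : p ≠ 2) (hmult : W.HasMultiplicativeReductionAtPrime p) (hirr : W.HasIrreducibleModPGaloisRep p)
    (hr : W.analyticRank = 1) (hf : IsNewformOf W f)
    (hu : ∃ u : ℚ, ‖(u : ℚ_[p])‖ = 1 ∧ W.realPeriodRat = u * plusPeriod f)
    {s : ℚ} (hs : shaAn W = (s : ℂ)) :
    ∃ k : ℕ, padicValRat p (s * W.tamagawaProduct) = k ∧
      ∀ ℓ : ℕ, ℓ.Prime → IsCyclicKolyvaginLevel W p ℓ → KuriharaDivisibleAt W p f ℓ k := by
  obtain ⟨k, hk, hpart⟩ := h hp hmult hirr hr f hf hu s hs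
  refine ⟨k, hk, fun ℓ hℓ hcyc => ?_⟩
  have hcard : ℓ.primeFactors.card = 1 := by rw [hℓ.primeFactors, Finset.card_singleton]
  have hle := kuriharaPartial_le W p f hcyc hcard
  rw [hpart] at hle
  exact kuriharaDivisibleAt_of_le_kuriharaDivIndex hle

/-- **Reading (P) of the equality shape**: under `CensusX11b2.PartialOneAt W p` and its hypotheses,
`∂^{(1)}(δ̃) = 0` (⟺ some cyclic Kolyvagin prime carries a unit Kurihara number,
`kuriharaPartial_one_eq_zero_iff`) **iff** `p ∤ #Ш_an · ∏ c_ℓ` (`ord_p = 0`). CONDITIONAL on an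
EVIDENCE-labelled conjecture; nothing asserted. [cite: Kim2022StructureSelmer, Thm. 1.9 (6), Conj. 1.10] -/
theorem CensusX11b2.partialOne_eq_zero_iff_of_partialOneAt (h : CensusX11b2.PartialOneAt W p)
    (hp : p ≠ 2) (hmult : W.HasMultiplicativeReductionAtPrime p) (hirr : W.HasIrreducibleModPGaloisRep p)
    (hr : W.analyticRank = 1) (hf : IsNewformOf W f)
    (hu : ∃ u : ℚ, ‖(u : ℚ_[p])‖ = 1 ∧ W.realPeriodRat = u * plusPeriod f)
    {s : ℚ} (hs : shaAn W = (s : ℂ)) :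
    kuriharaPartial W p f 1 = 0 ↔ padicValRat p (s * W.tamagawaProduct) = 0 := by
  obtain ⟨k, hk, hpart⟩ := h hp hmult hirr hr f hf hu s hs
  rw [hpart, hk]
  constructor
  · intro h0
    have : k = 0 := by exact_mod_cast h0
    simp [this]
  · intro h0
    have : (k : ℤ) = 0 := h0
    have hk0 : k = 0 := by exact_mod_cast this
    simp [hk0]

/-- **Reading (P), "⟹" direction, of (D2)**: under `CensusX11b2.KolyvaginDivisibilityAt W p` and its
hypotheses, ONE Kolyvagin prime `ℓ ∈ 𝒫_1` with a UNIT mod-`p` Kurihara number (for some surjective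
discrete logarithm) forces `ord_p(#Ш_an·∏_ℓ c_ℓ) = 0`, i.e. `p ∤ #Ш_an` AND `p ∤ c_ℓ` for every bad `ℓ`,
`c_p` included (if `m ≥ 1`, (D2) would make `δ̃_ℓ^{(1)}` vanish). Its `#Ш` part at `p ≥ 5`, `ρ̄` onto
is Kim's theorem (`card_sha_primary_eq_one_of_divIndex_eq_zero` below); its Tamagawa part is Kim's
Conjecture 1.10 direction. CONDITIONAL; nothing asserted. [cite: Kim2022StructureSelmer, Thm. 1.9 (1),(6), Conj. 1.10] -/
theorem CensusX11b2.padicValRat_eq_zero_of_ne_zero_of_kolyvaginDivisibilityAt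
    (h : CensusX11b2.KolyvaginDivisibilityAt W p)
    (hp : p ≠ 2) (hmult : W.HasMultiplicativeReductionAtPrime p) (hirr : W.HasIrreducibleModPGaloisRep p)
    (hr : W.analyticRank = 1) (hf : IsNewformOf W f)
    (hu : ∃ u : ℚ, ‖(u : ℚ_[p])‖ = 1 ∧ W.realPeriodRat = u * plusPeriod f)
    {s : ℚ} (hs : shaAn W = (s : ℂ)) {ℓ : ℕ} [NeZero ℓ] (hℓ : Kato.IsKolyvaginPrime W p 1 ℓ)
    (ψ : (q : ℕ) → (ZMod q)ˣ →* Multiplicative (ZMod (p ^ 1)))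
    (hψ : ∀ q ∈ ℓ.primeFactors, Function.Surjective (ψ q)) (hne : kuriharaNumber f (p ^ 1) ℓ ψ ≠ 0) :
    padicValRat p (s * W.tamagawaProduct) = 0 := by
  obtain ⟨m, hm, hdiv⟩ := h hp hmult hirr hr f hf hu s hs
  rcases Nat.eq_zero_or_pos m with rfl | hmpos
  · simpa using hm
  · exact absurd ((hdiv ℓ hℓ).anti hmpos 1 le_rfl hℓ.isKolyvaginProduct ψ hψ) hne

/-- **The in-print half at `p ≥ 5`, `ρ̄` onto (Kim 2026 Thm. 1.8 (1),(6) + Cor. 1.6, tree fact `hKim`):**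
a cyclic Kolyvagin prime `ℓ` with a UNIT level-one Kurihara number (`kuriharaDivIndex ℓ = 0`, i.e.
`∂^{(1)}(δ̃) = 0` by `kuriharaPartial_one_eq_zero_iff`) forces `#Ш(E/ℚ)[p^∞] = 1` in analytic rank
one at a good or multiplicative `p` — the "unit ⟹ `p ∤ #Ш`" half of (P) with the ACTUAL `Ш`, given
`Ш` finite (`hfin`) and `L(E,1) = 0` (`hL1`). CONDITIONAL on the named fact; nothing booked.
[cite: Kim2022StructureSelmer, Thm. 1.9 (1),(6) (PDF pp. 7–8), Cor. 1.6 (PDF p. 6)] -/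
theorem CensusX11b2.card_sha_primary_eq_one_of_divIndex_eq_zero
    (hKim : Kim2022_rankOne_card_sha_eq_one_of_kuriharaNumber_ne_zero) (hp5 : 5 ≤ p)
    (hred : W.HasGoodReductionAtPrime p ∨ W.HasMultiplicativeReductionAtPrime p)
    (hsurj : W.HasSurjectiveModNGaloisRep p) (hL1 : W.entireLFunction 1 = 0) (hr : W.analyticRank = 1)
    (hfin : Finite W.sha) (hf : IsNewformOf W f)
    (hu : ∃ u : ℚ, ‖(u : ℚ_[p])‖ = 1 ∧ W.realPeriodRat = u * plusPeriod f)
    {ℓ : ℕ} (hℓ : ℓ.Prime) (hcyc : IsCyclicKolyvaginLevel W p ℓ) (h0 : kuriharaDivIndex W p f ℓ = 0) :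
    Nat.card (AddCommGroup.primaryComponent W.sha p) = 1 := by
  haveI : Fact ℓ.Prime := ⟨hℓ⟩
  -- a unit: `¬ KuriharaDivisibleAt ℓ 1`, i.e. some surjective `ψ` at level `p^1` with `δ̃_ℓ(ψ) ≠ 0`
  have hnd : ¬ KuriharaDivisibleAt W p f ℓ 1 := (kuriharaDivIndex_eq_zero_iff ℓ).mp h0
  simp only [KuriharaDivisibleAt, not_forall] at hnd
  obtain ⟨k, hk1, hkol, ψ, hψ, hne⟩ := hnd
  -- `k ≤ 1` and level `p^0` imposes nothing (`ZMod 1` is trivial), so `k = 1`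
  have hk : k = 1 := by
    rcases Nat.le_one_iff_eq_zero_or_eq_one.mp hk1 with rfl | rfl
    · exfalso; apply hne
      haveI : Subsingleton (ZMod (p ^ 0)) := by rw [pow_zero]; infer_instance
      exact Subsingleton.elim _ _
    · rfl
  subst hk
  have hKP : Kato.IsKolyvaginPrime W p 1 ℓ := hkol.2 ℓ (by rw [hℓ.primeFactors]; simp)
  have hψℓ : Function.Surjective (ψ ℓ) := hψ ℓ (by rw [hℓ.primeFactors]; simp)
  exact hKim W p hp5 hred hsurj hL1 hr hfin f hf hu ℓ hKP (hcyc.2 ℓ (dvd_refl ℓ)) ψ hψℓ hne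

end Readings

end Summit.BirchSwinnertonDyer.Rank1Residual.X11b
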